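import Mathlib.Analysis.SpecialFunctions.Trigonometric.Basic
import Literature.Computability.MetaComplexity.PolynomialModmCorrelation
import Literature.Computability.MetaComplexity.HypercubeSchwartzZippel
import Summits.QuantumAdvantage.AdviceFreeQNC0.HammingLayerSums
import HarnessLib

/-!
# Cell qa-qnc0 (rung F-Q1, route RingFrame, crux α, line `product`): below degree `½ log₂ n` the
# support of an `𝔽₂`-polynomial is balanced over the three residue classes of the Hamming weight mod 3

Rung 0 of the planner's PLDAMS ladder (HOME/qa-qnc0-p1/TARGET.md §18.1, Sketch5.lean ns
`QaQnc0.Product5`: `SuppCharSumBound`, `PLDAMSLog`, `PLDAMSLogRung`, all marked "PROVED in prose"),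
now kernel theorems.  For `g : {0,1}ⁿ → 𝔽₂` of degree `≤ d` with support `B = {u : g u ≠ 0}` and
`S_B = Σ_{u ∈ B} ω^{|u|}` (`ω = e^{2πi/3}`):

* `norm_supportCharSum_le` (`SuppCharSumBound`): `‖S_B‖ ≤ (1 + 2ⁿ·e^{−3n/(8·4^d)})/2`.  Proof:
  `2·S_B = Σ_u ω^{|u|} − Σ_u (−1)^{g(u)} ω^{|u|}`, `|Σ_u ω^{|u|}| = |1 + ω|ⁿ = 1`, and the second sum is
  the Viola–Wigderson exponential sum at `ζ = ω` (tree theorem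
  `GowersCube.violaWigderson_cube_exp_bound`, with `Re ω^{2^d} = −½`, i.e. `θ = 3/2`).
* `three_mul_card_class_eq` / `abs_three_mul_card_class_sub_card_le`: the class `|u| ≡ r (mod 3)`
  carries `|B|/3 + (2/3)·Re(ω^{2r} S_B)` points of `B`, hence within `(1 + 2ⁿe^{−3n/(8·4^d)})/3` of
  `|B|/3` (equidistribution of low-degree supports mod 3).
* `card_support_le_four_mul_card_class` (`PLDAMSLog`): if `4(d+2)·4^d ≤ n` then EVERY residue class
  carries at least a quarter of the support — using the Schwartz–Zippel / Reed–Muller bound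
  `|B| ≥ 2^{n−d}` (tree theorem `Smolensky.two_pow_le_card_support`) to absorb the error term.
* `pldamsLogRung` (`PLDAMSLogRung` = `PLDAMSAt (fun n ↦ log₄ n − log₄(log₂ n + 1) − 3)` with
  `κ₀ = 1/4`, `n₀ = 8`): the degree profile of rung 0 satisfies `4(d+2)4^d ≤ n`.

Statements are literally the planner's (`suppOf`/`classOf`/`PLDAMSAt` unfolded), so
`PLDAMSLog := card_support_le_four_mul_card_class`, `PLDAMSLogRung := pldamsLogRung`,
`SuppCharSumBound := norm_supportCharSum_le`, and `DLSZF2 := fun _ _ _ hg hne =>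
Smolensky.two_pow_le_card_support hg hne` close the four §18.1 entries of `ProvableNow`.
This is the bc5-type witness BELOW the first open rung `PLDAMSCLog C` (`d = C·log₂ n`, `C > ½`) of
the line `product` for crux α; it is the cell's combination of two library theorems, not a result in
print, hence it lives in the cell topic.  WHAT THIS IS NOT: nothing at degree `≥ ½ log₂ n`; no claim
on `LDMAPolylog` or on α (`RingToElim`); no separation.

## References

* E. Viola, A. Wigderson, *Norms, XOR lemmas, and lower bounds for polynomials and protocols*,
  Theory of Computing 4 (2008), Thm. 2.9 [ViolaWigderson2008].
* S. Jukna, *Boolean Function Complexity* (2012), Claim 2.21 [JuknaBFC2012].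
-/

noncomputable section

namespace Summit.QuantumAdvantage.AdviceFreeQNC0

open Finset
open Literature.Computability.MetaComplexity Literature.Computability.MetaComplexity.Smolensky
open Literature.Computability.MetaComplexity.Hegedus Literature.Computability.MetaComplexity.GowersCube

variable {n : ℕ}

/-! ### The cube root of unity `ω` -/

/-- `ω = e^{2πi/3}` (same body as the planner's `QaQnc0.Product5.omega3`). [folklore] -/
def omega3 : ℂ := Complex.exp (2 * Real.pi * Complex.I / 3)

/-- `ω = e^{(2π/3) i}` with a real angle. [folklore] -/
theorem omega3_eq_exp : omega3 = Complex.exp (((2 * Real.pi / 3 : ℝ) : ℂ) * Complex.I) := by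
  unfold omega3
  congr 1
  push_cast
  ring

/-- `‖ω‖ = 1`. [folklore] -/
theorem norm_omega3 : ‖omega3‖ = 1 := by
  rw [omega3_eq_exp]
  exact Complex.norm_exp_ofReal_mul_I _

/-- `ω^m = e^{(2πm/3) i}`. [folklore] -/
theorem omega3_pow_eq_exp (m : ℕ) :
    omega3 ^ m = Complex.exp (((2 * Real.pi * m / 3 : ℝ) : ℂ) * Complex.I) := by
  rw [omega3_eq_exp, ← Complex.exp_nat_mul]
  congr 1
  push_cast
  ring

/-- `Re ω^m = cos(2πm/3)`. [folklore] -/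
theorem omega3_pow_re (m : ℕ) : (omega3 ^ m).re = Real.cos (2 * Real.pi * m / 3) := by
  rw [omega3_pow_eq_exp, Complex.exp_ofReal_mul_I_re]

/-- `ω³ = 1`. [folklore] -/
theorem omega3_pow_three : omega3 ^ 3 = 1 := by
  rw [omega3_eq_exp, ← Complex.exp_nat_mul]
  have : ((3 : ℕ) : ℂ) * (((2 * Real.pi / 3 : ℝ) : ℂ) * Complex.I) = 2 * Real.pi * Complex.I := by
    push_cast
    ring
  rw [this, Complex.exp_two_pi_mul_I]

/-- `ω^m = ω^{m mod 3}`. [folklore] -/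
theorem omega3_pow_eq_pow_mod (m : ℕ) : omega3 ^ m = omega3 ^ (m % 3) := by
  conv_lhs => rw [← Nat.div_add_mod m 3, pow_add, pow_mul, omega3_pow_three, one_pow, one_mul]

/-- `Re ω = Re ω² = −½`: for `m ≢ 0 (mod 3)`, `Re ω^m = −½`. [folklore] -/
theorem omega3_pow_re_of_mod_ne_zero {m : ℕ} (hm : m % 3 ≠ 0) : (omega3 ^ m).re = -1 / 2 := by
  rw [omega3_pow_eq_pow_mod, omega3_pow_re]
  have h12 : m % 3 = 1 ∨ m % 3 = 2 := by omega
  rcases h12 with h | h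
  · rw [h]
    have : 2 * Real.pi * ((1 : ℕ) : ℝ) / 3 = Real.pi - Real.pi / 3 := by push_cast; ring
    rw [this, Real.cos_pi_sub, Real.cos_pi_div_three]
    norm_num
  · rw [h]
    have : 2 * Real.pi * ((2 : ℕ) : ℝ) / 3 = Real.pi / 3 + Real.pi := by push_cast; ring
    rw [this, Real.cos_add_pi, Real.cos_pi_div_three]
    norm_num

/-- For `m ≡ 0 (mod 3)`, `ω^m = 1`. [folklore] -/
theorem omega3_pow_eq_one_of_mod_eq_zero {m : ℕ} (hm : m % 3 = 0) : omega3 ^ m = 1 := by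
  rw [omega3_pow_eq_pow_mod, hm, pow_zero]

/-- The character formula for the class indicator: `1 + 2·Re ω^m = 3·[3 ∣ m]`. [folklore] -/
theorem one_add_two_mul_omega3_pow_re (m : ℕ) :
    1 + 2 * (omega3 ^ m).re = if m % 3 = 0 then 3 else 0 := by
  split_ifs with h
  · rw [omega3_pow_eq_one_of_mod_eq_zero h, Complex.one_re]
    norm_num
  · rw [omega3_pow_re_of_mod_ne_zero h]
    norm_num

/-- `ω ≠ 1`. [folklore] -/
theorem omega3_ne_one : omega3 ≠ 1 := by
  intro h
  have := omega3_pow_re_of_mod_ne_zero (m := 1) (by norm_num)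
  rw [pow_one, h, Complex.one_re] at this
  norm_num at this

/-- `1 + ω + ω² = 0`. [folklore] -/
theorem one_add_omega3_add_sq : 1 + omega3 + omega3 ^ 2 = 0 := by
  have h : (omega3 - 1) * (1 + omega3 + omega3 ^ 2) = 0 := by
    have h3 := omega3_pow_three
    linear_combination h3
  rcases mul_eq_zero.1 h with h1 | h1
  · exact (omega3_ne_one (sub_eq_zero.1 h1)).elim
  · exact h1

/-- `|1 + ω| = 1` (`1 + ω = −ω²`). [folklore] -/
theorem norm_one_add_omega3 : ‖1 + omega3‖ = 1 := by
  have h : 1 + omega3 = -omega3 ^ 2 := by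
    have := one_add_omega3_add_sq
    linear_combination this
  rw [h, norm_neg, norm_pow, norm_omega3, one_pow]

/-! ### Character sums over the cube -/

/-- `ω^{|u|} = Π_i (ω if uᵢ = 1 else 1)`. [folklore] -/
theorem omega3_pow_wt (u : Fin n → Bool) :
    omega3 ^ wt u = ∏ i, (if u i = true then omega3 else 1) := by
  rw [wt, ← Finset.prod_filter, Finset.prod_const]

/-- `Σ_{u ∈ {0,1}ⁿ} ω^{|u|} = (1 + ω)ⁿ`. [folklore] -/
theorem sum_omega3_pow_wt (n : ℕ) : ∑ u : Fin n → Bool, omega3 ^ wt u = (1 + omega3) ^ n := by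
  simp_rw [omega3_pow_wt]
  have h := Finset.prod_univ_sum (fun _ : Fin n => (univ : Finset Bool))
    (fun _ b => if b = true then omega3 else 1)
  rw [Fintype.piFinset_univ] at h
  rw [← h, Finset.prod_const, Finset.card_univ, Fintype.card_fin]
  congr 1
  rw [Fintype.sum_bool]
  simp only [↓reduceIte, Bool.false_eq_true]
  ring

/-- `|Σ_u ω^{|u|}| = 1`. [folklore] -/
theorem norm_sum_omega3_pow_wt (n : ℕ) : ‖∑ u : Fin n → Bool, omega3 ^ wt u‖ = 1 := by
  rw [sum_omega3_pow_wt, norm_pow, norm_one_add_omega3, one_pow]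

/-- The Viola–Wigderson bound at `ζ = ω`: for `g` of degree `≤ d`,
`|Σ_u (−1)^{g(u)} ω^{|u|}| ≤ 2ⁿ·e^{−3n/(8·4^d)}` (`1 − Re ω^{2^d} = 3/2` as `3 ∤ 2^d`).
[cite: ViolaWigderson2008, Theorem 2.9] -/
theorem norm_sum_signChar_mul_omega3_pow_le {d : ℕ} {g : CubeFn (ZMod 2) n}
    (hg : g ∈ lowDeg (ZMod 2) n d) :
    ‖∑ u : Fin n → Bool, signChar (g u) * omega3 ^ wt u‖ ≤
      (2 : ℝ) ^ n * Real.exp (-(3 * (n : ℝ) / (8 * 4 ^ d))) := by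
  have h := violaWigderson_cube_exp_bound hg norm_omega3
  have hre : (omega3 ^ 2 ^ d).re = -1 / 2 :=
    omega3_pow_re_of_mod_ne_zero (two_pow_mod_three_ne_zero d)
  rw [hre, norm_div, Complex.norm_pow, Complex.norm_ofNat,
    div_le_iff₀ (by positivity : (0 : ℝ) < 2 ^ n)] at h
  have hexp : -((1 - (-1 / 2 : ℝ)) * n / 4 ^ (d + 1)) = -(3 * (n : ℝ) / (8 * 4 ^ d)) := by
    rw [pow_succ]
    ring
  rw [hexp] at h
  simpa only [wt, mul_comm] using h

/-- **`SuppCharSumBound` (planner Sketch5 §18.1).** For `g` of degree `≤ d` with support `B`,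
`‖Σ_{u ∈ B} ω^{|u|}‖ ≤ (1 + 2ⁿ·e^{−3n/(8·4^d)})/2`, because
`2·Σ_{u∈B} ω^{|u|} = Σ_u ω^{|u|} − Σ_u (−1)^{g(u)} ω^{|u|}`.
[cite: ViolaWigderson2008, Theorem 2.9 (applied at ζ = ω)] -/
theorem norm_supportCharSum_le (n d : ℕ) (g : CubeFn (ZMod 2) n) (hg : g ∈ lowDeg (ZMod 2) n d) :
    ‖∑ u ∈ univ.filter (fun u : Fin n → Bool => g u ≠ 0), omega3 ^ wt u‖ ≤
      (1 + (2 : ℝ) ^ n * Real.exp (-(3 * (n : ℝ) / (8 * 4 ^ d)))) / 2 := by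
  set S := ∑ u ∈ univ.filter (fun u : Fin n → Bool => g u ≠ 0), omega3 ^ wt u with hS
  set T := ∑ u : Fin n → Bool, omega3 ^ wt u with hT
  set V := ∑ u : Fin n → Bool, signChar (g u) * omega3 ^ wt u with hV
  have hid : V = T - 2 * S := by
    have hS' : S = ∑ u : Fin n → Bool, if g u ≠ 0 then omega3 ^ wt u else 0 := by
      rw [hS, Finset.sum_filter]
    rw [hS', hT, hV, Finset.mul_sum, ← Finset.sum_sub_distrib]
    refine Finset.sum_congr rfl fun u _ => ?_
    by_cases hu : g u = 0
    · simp [hu, signChar]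
    · simp [hu, signChar]
      ring
  have h2S : 2 * S = T - V := by rw [hid]; ring
  have hnorm : 2 * ‖S‖ ≤ 1 + (2 : ℝ) ^ n * Real.exp (-(3 * (n : ℝ) / (8 * 4 ^ d))) := by
    calc 2 * ‖S‖ = ‖2 * S‖ := by rw [norm_mul, Complex.norm_ofNat]
      _ = ‖T - V‖ := by rw [h2S]
      _ ≤ ‖T‖ + ‖V‖ := norm_sub_le _ _
      _ ≤ 1 + (2 : ℝ) ^ n * Real.exp (-(3 * (n : ℝ) / (8 * 4 ^ d))) := by
          rw [hT, norm_sum_omega3_pow_wt]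
          have hVle : ‖V‖ ≤ (2 : ℝ) ^ n * Real.exp (-(3 * (n : ℝ) / (8 * 4 ^ d))) :=
            norm_sum_signChar_mul_omega3_pow_le hg
          linarith
  linarith

/-! ### Counting a residue class with characters -/

/-- The class-count identity: for every finite `B ⊆ {0,1}ⁿ` and every `r`,
`3·#{u ∈ B : |u| ≡ r (3)} = #B + 2·Re(ω^{2r}·Σ_{u∈B} ω^{|u|})`. [folklore] -/
theorem three_mul_card_filter_mod_eq (B : Finset (Fin n → Bool)) (r : ℕ) :
    (3 : ℝ) * (B.filter fun u => wt u % 3 = r % 3).card =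
      B.card + 2 * (omega3 ^ (2 * r) * ∑ u ∈ B, omega3 ^ wt u).re := by
  rw [Finset.mul_sum, Complex.re_sum, Finset.card_filter, Nat.cast_sum, Finset.mul_sum,
    Finset.card_eq_sum_ones B, Nat.cast_sum, Finset.mul_sum, ← Finset.sum_add_distrib]
  refine Finset.sum_congr rfl fun u _ => ?_
  rw [← pow_add, add_comm (2 * r), Nat.cast_one, one_add_two_mul_omega3_pow_re]
  have hiff : wt u % 3 = r % 3 ↔ (wt u + 2 * r) % 3 = 0 := by omega
  by_cases h : wt u % 3 = r % 3
  · rw [if_pos h, if_pos (hiff.1 h)]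
    norm_num
  · rw [if_neg h, if_neg fun h' => h (hiff.2 h')]
    norm_num

/-- Hence `|3·#{u ∈ B : |u| ≡ r (3)} − #B| ≤ 2·‖Σ_{u∈B} ω^{|u|}‖`. [folklore] -/
theorem abs_three_mul_card_filter_mod_sub_card_le (B : Finset (Fin n → Bool)) (r : ℕ) :
    |(3 : ℝ) * (B.filter fun u => wt u % 3 = r % 3).card - B.card| ≤ 2 * ‖∑ u ∈ B, omega3 ^ wt u‖ := by
  rw [three_mul_card_filter_mod_eq, add_sub_cancel_left, abs_mul, abs_two]
  refine mul_le_mul_of_nonneg_left ?_ (by norm_num)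
  calc |(omega3 ^ (2 * r) * ∑ u ∈ B, omega3 ^ wt u).re|
      ≤ ‖omega3 ^ (2 * r) * ∑ u ∈ B, omega3 ^ wt u‖ := Complex.abs_re_le_norm _
    _ = ‖∑ u ∈ B, omega3 ^ wt u‖ := by rw [norm_mul, norm_pow, norm_omega3, one_pow, one_mul]

/-- **Equidistribution of low-degree supports mod 3.** For `g` of degree `≤ d` on `{0,1}ⁿ` and
every `r`: `|3·#{u : g u ≠ 0, |u| ≡ r (3)} − #{u : g u ≠ 0}| ≤ 1 + 2ⁿ·e^{−3n/(8·4^d)}`.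
[cite: ViolaWigderson2008, Theorem 2.9 (applied at ζ = ω)] -/
theorem abs_three_mul_card_class_sub_card_support_le {d : ℕ} (g : CubeFn (ZMod 2) n)
    (hg : g ∈ lowDeg (ZMod 2) n d) (r : ℕ) :
    |(3 : ℝ) * (univ.filter fun u : Fin n → Bool => g u ≠ 0 ∧ wt u % 3 = r % 3).card -
        (univ.filter fun u : Fin n → Bool => g u ≠ 0).card| ≤
      1 + (2 : ℝ) ^ n * Real.exp (-(3 * (n : ℝ) / (8 * 4 ^ d))) := by
  have h := abs_three_mul_card_filter_mod_sub_card_le (univ.filter fun u : Fin n → Bool => g u ≠ 0) r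
  rw [Finset.filter_filter] at h
  have h2 := norm_supportCharSum_le n d g hg
  linarith

/-! ### `PLDAMSLog`: every class carries a quarter of the support -/

/-- `e^{3/2} ≥ 4`. [folklore] -/
private theorem four_le_exp_three_halves : (4 : ℝ) ≤ Real.exp (3 / 2) := by
  have h1 : (2.7182818283 : ℝ) < Real.exp 1 := Real.exp_one_gt_d9
  have h2 : (1 / 2 : ℝ) + 1 ≤ Real.exp (1 / 2) := Real.add_one_le_exp _
  have h3 : Real.exp (3 / 2) = Real.exp 1 * Real.exp (1 / 2) := by
    rw [← Real.exp_add]; norm_num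
  rw [h3]
  nlinarith [Real.exp_pos 1, Real.exp_pos (1 / 2 : ℝ)]

/-- The error term is absorbed by the Reed–Muller bound: if `4(d+2)4^d ≤ n` then
`4·(1 + 2ⁿ e^{−3n/(8·4^d)}) ≤ 2^{n−d}`. [folklore] -/
theorem four_mul_one_add_err_le_two_pow {n d : ℕ} (hn : 4 * (d + 2) * 4 ^ d ≤ n) :
    4 * (1 + (2 : ℝ) ^ n * Real.exp (-(3 * (n : ℝ) / (8 * 4 ^ d)))) ≤ (2 : ℝ) ^ (n - d) := by
  have h4d : (1 : ℝ) ≤ 4 ^ d := one_le_pow₀ (by norm_num)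
  have hdn : d + 3 ≤ n := by
    have : 4 * (d + 2) ≤ 4 * (d + 2) * 4 ^ d := Nat.le_mul_of_pos_right _ (by positivity)
    omega
  have hn' : (4 : ℝ) * (d + 2) * 4 ^ d ≤ n := by exact_mod_cast hn
  -- (i) the exponent is at least `3(d+2)/2`
  have hexp : Real.exp (-(3 * (n : ℝ) / (8 * 4 ^ d))) ≤ Real.exp (-(3 / 2)) ^ (d + 2) := by
    rw [← Real.exp_nat_mul, Real.exp_le_exp]
    have : (3 : ℝ) / 2 * (d + 2) ≤ 3 * (n : ℝ) / (8 * 4 ^ d) := by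
      rw [le_div_iff₀ (by positivity)]
      nlinarith
    push_cast
    linarith
  -- (ii) `e^{-3/2} ≤ 1/4`
  have hq : Real.exp (-(3 / 2 : ℝ)) ≤ 1 / 4 := by
    rw [Real.exp_neg, inv_le_comm₀ (Real.exp_pos _) (by norm_num)]
    norm_num
    exact four_le_exp_three_halves
  have hq' : Real.exp (-(3 / 2 : ℝ)) ^ (d + 2) ≤ (1 / 4 : ℝ) ^ (d + 2) :=
    pow_le_pow_left₀ (Real.exp_nonneg _) hq _
  -- (iii) `2ⁿ (1/4)^{d+2} ≤ 2^{n-d}/16`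
  have hsplit : (2 : ℝ) ^ n = 2 ^ (n - d) * 2 ^ d := by
    rw [← pow_add, Nat.sub_add_cancel (by omega)]
  have h24 : (2 : ℝ) ^ d ≤ 4 ^ d := pow_le_pow_left₀ (by norm_num) (by norm_num) d
  have hiii : (2 : ℝ) ^ n * (1 / 4 : ℝ) ^ (d + 2) ≤ 2 ^ (n - d) / 16 := by
    have hkey : (2 : ℝ) ^ d * (4 ^ d)⁻¹ ≤ 1 := by
      rw [mul_inv_le_iff₀ (by positivity), one_mul]
      exact h24
    have h4ne : (4 : ℝ) ^ d ≠ 0 := by positivity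
    calc (2 : ℝ) ^ n * (1 / 4 : ℝ) ^ (d + 2)
        = 2 ^ (n - d) / 16 * (2 ^ d * (4 ^ d)⁻¹) := by
          rw [hsplit, one_div_pow, pow_add]
          field_simp
          ring
      _ ≤ 2 ^ (n - d) / 16 * 1 := mul_le_mul_of_nonneg_left hkey (by positivity)
      _ = 2 ^ (n - d) / 16 := mul_one _
  -- (iv) `2^{n-d} ≥ 8`
  have h8 : (8 : ℝ) ≤ 2 ^ (n - d) := by
    have : (2 : ℝ) ^ 3 ≤ 2 ^ (n - d) := pow_le_pow_right₀ (by norm_num) (by omega)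
    norm_num at this
    exact this
  have herr : (2 : ℝ) ^ n * Real.exp (-(3 * (n : ℝ) / (8 * 4 ^ d))) ≤ 2 ^ (n - d) / 16 :=
    calc (2 : ℝ) ^ n * Real.exp (-(3 * (n : ℝ) / (8 * 4 ^ d)))
        ≤ 2 ^ n * Real.exp (-(3 / 2)) ^ (d + 2) := mul_le_mul_of_nonneg_left hexp (by positivity)
      _ ≤ 2 ^ n * (1 / 4 : ℝ) ^ (d + 2) := mul_le_mul_of_nonneg_left hq' (by positivity)
      _ ≤ 2 ^ (n - d) / 16 := hiii
  linarith

/-- **`PLDAMSLog` (planner Sketch5 §18.1): below degree `½log₂ n` every residue class mod 3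
carries at least a quarter of the support.** If `4(d+2)·4^d ≤ n`, `g ∈ lowDeg 𝔽₂ n d`, then for
every `r`: `#{u : g u ≠ 0} ≤ 4·#{u : g u ≠ 0, |u| ≡ r (mod 3)}`. (Viola–Wigderson at `ζ = ω` +
Schwartz–Zippel on the cube; the cell's combination, not in print.)
[cite: ViolaWigderson2008, Theorem 2.9; JuknaBFC2012, Claim 2.21] -/
theorem card_support_le_four_mul_card_class :
    ∀ n d : ℕ, 4 * (d + 2) * 4 ^ d ≤ n → ∀ g : CubeFn (ZMod 2) n, g ∈ lowDeg (ZMod 2) n d → ∀ r : ℕ,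
      (univ.filter fun u : Fin n → Bool => g u ≠ 0).card ≤
        4 * (univ.filter fun u : Fin n → Bool => g u ≠ 0 ∧ wt u % 3 = r % 3).card := by
  intro n d hn g hg r
  by_cases hg0 : g = 0
  · subst hg0
    simp
  have hB : (2 : ℝ) ^ (n - d) ≤ (univ.filter fun u : Fin n → Bool => g u ≠ 0).card := by
    exact_mod_cast two_pow_le_card_support hg hg0
  have hcls := abs_three_mul_card_class_sub_card_support_le g hg r
  have herr := four_mul_one_add_err_le_two_pow hn
  have h := (abs_le.1 hcls).1
  have hreal : ((univ.filter fun u : Fin n → Bool => g u ≠ 0).card : ℝ) ≤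
      4 * (univ.filter fun u : Fin n → Bool => g u ≠ 0 ∧ wt u % 3 = r % 3).card := by
    linarith
  exact_mod_cast hreal

/-! ### Rung 0 of the ladder: the degree profile `log₄ n − log₄(log₂ n + 1) − 3` -/

/-- The rung-0 degree profile satisfies the hypothesis of `PLDAMSLog`: for `n ≥ 8` and
`d ≤ log₄ n − log₄(log₂ n + 1) − 3` one has `4(d+2)4^d ≤ n`. [folklore] -/
theorem four_mul_succ_mul_four_pow_le {n d : ℕ} (hn : 8 ≤ n)
    (hd : d ≤ Nat.log 4 n - Nat.log 4 (Nat.log 2 n + 1) - 3) : 4 * (d + 2) * 4 ^ d ≤ n := by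
  set a := Nat.log 4 n with ha
  set m := Nat.log 2 n with hm
  set b := Nat.log 4 (m + 1) with hb
  by_cases hab : b + 3 ≤ a
  · have hdab : d + (b + 1) + 2 ≤ a := by omega
    have h4a : 4 ^ a ≤ n := Nat.pow_log_le_self 4 (by omega)
    have hmb : m + 1 < 4 ^ (b + 1) := Nat.lt_pow_succ_log_self (by norm_num) (m + 1)
    have ham : a ≤ m := Nat.log_anti_left (by norm_num) (by norm_num)
    have hdm : d ≤ m := by omega
    calc 4 * (d + 2) * 4 ^ d ≤ 16 * (m + 2) * 4 ^ d := by
          apply Nat.mul_le_mul_right; omega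
      _ ≤ 16 * 4 ^ (b + 1) * 4 ^ d := by
          apply Nat.mul_le_mul_right; apply Nat.mul_le_mul_left; omega
      _ = 4 ^ (d + (b + 1) + 2) := by ring
      _ ≤ 4 ^ a := Nat.pow_le_pow_right (by norm_num) hdab
      _ ≤ n := h4a
  · have hd0 : d = 0 := by omega
    subst hd0
    omega

/-- **`PLDAMSLogRung` — rung 0 of the PLDAMS ladder (planner Sketch5 §18.1), with `κ₀ = 1/4`,
`n₀ = 8`:** for `n ≥ 8`, every `d ≤ log₄ n − log₄(log₂ n + 1) − 3`, every `g ∈ lowDeg 𝔽₂ n d` and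
every `r`, `¼·#{u : g u ≠ 0} ≤ #{u : g u ≠ 0, |u| ≡ r (mod 3)}`.  Literally
`QaQnc0.Product5.PLDAMSAt (fun n => Nat.log 4 n - Nat.log 4 (Nat.log 2 n + 1) - 3)`.
[cite: ViolaWigderson2008, Theorem 2.9; JuknaBFC2012, Claim 2.21] -/
theorem pldamsLogRung :
    ∃ κ₀ : ℝ, 0 < κ₀ ∧ ∃ n₀ : ℕ, ∀ n : ℕ, n₀ ≤ n → ∀ d : ℕ,
      d ≤ (fun n => Nat.log 4 n - Nat.log 4 (Nat.log 2 n + 1) - 3) n →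
        ∀ g : CubeFn (ZMod 2) n, g ∈ lowDeg (ZMod 2) n d → ∀ r : ℕ,
          κ₀ * ((univ.filter fun u : Fin n → Bool => g u ≠ 0).card : ℝ) ≤
            ((univ.filter fun u : Fin n → Bool => g u ≠ 0 ∧ wt u % 3 = r % 3).card : ℝ) := by
  refine ⟨1 / 4, by norm_num, 8, fun n hn d hd g hg r => ?_⟩
  have h := card_support_le_four_mul_card_class n d (four_mul_succ_mul_four_pow_le hn hd) g hg r
  have h' : ((univ.filter fun u : Fin n → Bool => g u ≠ 0).card : ℝ) ≤
      4 * ((univ.filter fun u : Fin n → Bool => g u ≠ 0 ∧ wt u % 3 = r % 3).card : ℝ) := by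
    exact_mod_cast h
  linarith

end Summit.QuantumAdvantage.AdviceFreeQNC0
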